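import Summits.ABC.ABC.Theses.FeketeScales
import Summits.ABC.ABC.Theorems.FeketeScalesAssembly
import HarnessLib

/-!
# Route FeketeScales — crux `SparseGoodScales` (stmt-ABC-2161): upper propagation from ONE scale
# with an arbitrary exponent, and flatness at a drought scale

Helper file (`--supports stmt-ABC-2161`) for the crux `SparseGoodScales` of route `FeketeScales`,
line `SketchIdeator4` of `Cruxes/SparseGoodScales/` (round-2 ideator 4's sorry-free package
`Cruxes/SparseGoodScales/SketchIdeator4.lean`, `BarrierNotes-r2-k4.md` §2–§3), first half: the two
tools of the reduction `ScaleSubmultiplicativity → DA∃ → SparseGoodScales`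
(`Theorems/FeketeScalesSparseGoodScalesMinimalResidue.lean`), in the tree's vocabulary
(`IsABCTriple`, `rad`; no new definitions).

* `flat_of_drought` — at a scale `R` whose window `(R^{1/Λ}, R]` carries no abc triple of quality
  `> 1+δ` ("drought scale"), the record height is attained BELOW the window or is `≤ R^{1+δ}`;
* `upper_propagation` — the finitary Fekete upgrade of `Theorems/FeketeScalesAssembly.lean`
  (`FeketeScalesAssembly.allScales`) run from ONE seed scale `S` with ANY exponent `q ≥ 0` under the
  normalised sub-multiplicativity (`0 ≤ θ < 1`, slack `e^L e^{(log R₁R₂)^θ}`, scales `≥ R₀`): if every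
  abc triple of radical `≤ S` has `c ≤ S^q` and `log S` exceeds a threshold depending only on
  `(θ, L, δ)`, then `c ≤ e^B · rad^{q+2δ}` for EVERY abc triple.  With `q = 1+δ` this is the route's
  Assembly; with `q = sq(X)` at an arbitrary scale it gives the in-route rigidity "lim log G(R)/log R
  exists" of `BarrierNotes-r2-k4.md` §3.
-/

-- `Summit.<Summit>.<Problem>` is the mandated summit-side namespace (CONVENTIONS §2); for the
-- single-conjunct summit `ABC` the two coincide, so the duplicate `ABC.ABC` is deliberate.
set_option linter.dupNamespace false

namespace Summit.ABC.ABC.Theorems.SparseGoodScales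

open Literature.NumberTheory.DiophantineGeometry
open Summit.ABC.ABC.Theses.FeketeScales
open Summit.ABC.ABC.Theorems

/-- **Flatness at a drought scale** (the one new move of this round).  If at scale `R` the window
`(R^{1/Λ}, R]` carries no triple of quality `> 1+δ`, and every triple BELOW the window
(`rad^Λ ≤ R`) has `c ≤ Y`, then every triple of radical `≤ R` has `c ≤ max Y R^{1+δ}`: the record
`G(R)` is attained below the window or is `≤ R^{1+δ}`.  With `R` `ε`-bad (`G(R) > R^{1+ε}`,
`ε > δ`) this reads `G(R) = G(R^{1/Λ})`, i.e. `sq(R) = sq(R^{1/Λ})/Λ` — incompatible with the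
Fekete-type upper propagation that `ScaleSubmultiplicativity` provides. [folklore] -/
theorem flat_of_drought {δ Λ Y : ℝ} {R : ℕ} (hδ : 0 ≤ 1 + δ)
    (hD : ∀ a b c : ℕ, IsABCTriple a b c → rad a b c ≤ R → (R : ℝ) < ((rad a b c : ℕ) : ℝ) ^ Λ →
      (c : ℝ) ≤ ((rad a b c : ℕ) : ℝ) ^ (1 + δ))
    (hY : ∀ a b c : ℕ, IsABCTriple a b c → ((rad a b c : ℕ) : ℝ) ^ Λ ≤ R → (c : ℝ) ≤ Y) :
    ∀ a b c : ℕ, IsABCTriple a b c → rad a b c ≤ R → (c : ℝ) ≤ max Y ((R : ℝ) ^ (1 + δ)) := by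
  intro a b c habc hrad
  rcases lt_or_ge (R : ℝ) (((rad a b c : ℕ) : ℝ) ^ Λ) with hwin | hbelow
  · have h1 : (c : ℝ) ≤ ((rad a b c : ℕ) : ℝ) ^ (1 + δ) := hD a b c habc hrad hwin
    have h2 : ((rad a b c : ℕ) : ℝ) ^ (1 + δ) ≤ (R : ℝ) ^ (1 + δ) :=
      Real.rpow_le_rpow (Nat.cast_nonneg _) (by exact_mod_cast hrad) hδ
    exact (h1.trans h2).trans (le_max_right _ _)
  · exact (hY a b c habc hbelow).trans (le_max_left _ _)

/-- **Upper propagation from one scale with an arbitrary exponent** (the Fekete upgrade of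
`FeketeScalesAssembly.abc_of_submult_of_sparseGoodScales`, with the good-scale exponent `1+δ`
replaced by any `q ≥ 0`).  Under the normalised sub-multiplicativity (`0 ≤ θ < 1`, slack
`e^L e^{(log R₁R₂)^θ}`, scales `≥ R₀`) and for every `δ > 0` there is a threshold `T` such that:
if `S ≥ max R₀ 2`, `log S ≥ T` and every abc triple of radical `≤ S` has `c ≤ S^q`, then
`c ≤ e^B rad(abc)^{q+2δ}` for EVERY abc triple, for some real `B`. [folklore] -/
theorem upper_propagation {θ L : ℝ} {R₀ : ℕ} (hθ0 : 0 ≤ θ) (hθ1 : θ < 1) (hL : 0 ≤ L)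
    (hsub : ∀ R₁ R₂ : ℕ, R₀ ≤ R₁ → R₀ ≤ R₂ → ∀ a b c : ℕ, IsABCTriple a b c → rad a b c ≤ R₁ * R₂ →
      ∃ a₁ b₁ c₁ a₂ b₂ c₂ : ℕ, IsABCTriple a₁ b₁ c₁ ∧ rad a₁ b₁ c₁ ≤ R₁ ∧ IsABCTriple a₂ b₂ c₂ ∧
        rad a₂ b₂ c₂ ≤ R₂ ∧
        (c : ℝ) ≤ Real.exp L * Real.exp (Real.log ((R₁ : ℝ) * R₂) ^ θ) * c₁ * c₂)
    {δ : ℝ} (hδ0 : 0 < δ) :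
    ∃ T : ℝ, ∀ (S : ℕ) (q : ℝ), R₀ ≤ S → 2 ≤ S → T ≤ Real.log S → 0 ≤ q →
      (∀ a b c : ℕ, IsABCTriple a b c → rad a b c ≤ S → (c : ℝ) ≤ (S : ℝ) ^ q) →
      ∃ B : ℝ, ∀ a b c : ℕ, IsABCTriple a b c →
        (c : ℝ) ≤ Real.exp B * ((rad a b c : ℕ) : ℝ) ^ (q + 2 * δ) := by
  -- constants attached to `θ`
  have h2θ : (2:ℝ) ^ θ < 2 := by
    have := Real.rpow_lt_rpow_of_exponent_lt (by norm_num : (1:ℝ) < 2) hθ1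
    rwa [Real.rpow_one] at this
  have h2θpos : 0 < (2:ℝ) ^ θ := by positivity
  set κ : ℝ := δ * (2 - (2:ℝ) ^ θ) with hκ
  have hκ0 : 0 < κ := mul_pos hδ0 (by linarith)
  -- a threshold `T` with `L + 2^θ t^θ ≤ κ t` for all `t ≥ T`
  obtain ⟨B₁, hB₁0, hB₁⟩ :=
    FeketeScalesAssembly.rpow_le_linear_add_const hθ0 hθ1 (a := κ / (2 * (2:ℝ) ^ θ))
      (by positivity)
  set T : ℝ := 2 * (L + (2:ℝ) ^ θ * B₁) / κ with hT
  have hT' : κ / 2 * T = L + (2:ℝ) ^ θ * B₁ := by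
    rw [hT]; field_simp
  have hstep1 : ∀ t : ℝ, 0 ≤ t → T ≤ t → L + (2:ℝ) ^ θ * t ^ θ ≤ κ * t := by
    intro t ht hTt
    have h1 := mul_le_mul_of_nonneg_left (hB₁ t ht) h2θpos.le
    have e : (2:ℝ) ^ θ * (κ / (2 * (2:ℝ) ^ θ) * t + B₁) = κ / 2 * t + (2:ℝ) ^ θ * B₁ := by
      field_simp
    have h3 := mul_le_mul_of_nonneg_left hTt (by positivity : (0:ℝ) ≤ κ / 2)
    linarith
  refine ⟨T, fun S q hR₀S hS2 hTS hq0 hP => ?_⟩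
  have hS1 : 1 ≤ S := by omega
  have hSpos : (0:ℝ) < S := by positivity
  have hS1' : (1:ℝ) < S := by exact_mod_cast hS2
  set t : ℝ := Real.log S with ht_def
  have htpos : 0 < t := Real.log_pos hS1'
  -- the constants of `allScales`
  have hβ : L + (2:ℝ) ^ θ * (Real.log S) ^ θ ≤ δ * t * (2 - (2:ℝ) ^ θ) := by
    have := hstep1 t htpos.le hTS
    rw [hκ] at this
    rw [← ht_def]; linarith
  have hβ0 : 0 ≤ δ * t := by positivity
  set φ : ℝ := (1 + θ) / 2 with hφ
  have hθφ : θ ≤ φ := by rw [hφ]; linarith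
  have hφ0 : 0 < φ := by rw [hφ]; linarith
  have hφ1 : φ < 1 := by rw [hφ]; linarith
  have h2φ : (2:ℝ) ^ (-φ) < 1 := Real.rpow_lt_one_of_one_lt_of_neg (by norm_num) (by linarith)
  have htθ : 0 < t ^ θ := Real.rpow_pos_of_pos htpos θ
  set γ : ℝ := (L + t ^ θ) / (1 - (2:ℝ) ^ (-φ)) with hγ_def
  have hγpos : 0 < γ := div_pos (by linarith) (by linarith)
  have hγ : L + (Real.log S) ^ θ ≤ γ * (1 - (2:ℝ) ^ (-φ)) := by
    rw [← ht_def, hγ_def, div_mul_cancel₀ _ (by linarith)]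
  -- the iteration, for the predicate "every abc triple with `rad ≤ S'` has `c ≤ X`"
  have hall := FeketeScalesAssembly.allScales
    (fun (S' : ℕ) (X : ℝ) => ∀ a b c : ℕ, IsABCTriple a b c → rad a b c ≤ S' → (c : ℝ) ≤ X)
    (b := q * t) hθ0 hθφ hL hβ0 hγpos.le hR₀S hS1 hβ hγ
    (fun S' X Y hP' hXY a b c h1 h2 => (hP' a b c h1 h2).trans hXY)
    (by
      intro S₁ S₂ hS₁ hS₂ X₁ X₂ hX₁ hX₂ hP₁ hP₂ a b c habc hrad
      obtain ⟨a₁, b₁, c₁, a₂, b₂, c₂, h₁, hr₁, h₂, hr₂, hc⟩ := hsub S₁ S₂ hS₁ hS₂ a b c habc hrad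
      have hc₁ : (c₁ : ℝ) ≤ X₁ := hP₁ a₁ b₁ c₁ h₁ hr₁
      have hc₂ : (c₂ : ℝ) ≤ X₂ := hP₂ a₂ b₂ c₂ h₂ hr₂
      calc (c : ℝ) ≤ Real.exp L * Real.exp (Real.log ((S₁ : ℝ) * S₂) ^ θ) * c₁ * c₂ := hc
        _ ≤ Real.exp L * Real.exp (Real.log ((S₁ : ℝ) * S₂) ^ θ) * X₁ * X₂ := by gcongr)
    (by
      intro a b c habc hrad
      have := hP a b c habc hrad
      rwa [Real.rpow_def_of_pos hSpos, mul_comm] at this)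
  -- sublinearity of `N ↦ γ N^φ`
  obtain ⟨B₂, hB₂0, hB₂⟩ :=
    FeketeScalesAssembly.rpow_le_linear_add_const hφ0.le hφ1 (a := δ * t / γ) (by positivity)
  set B : ℝ := (q + 2 * δ) * t + γ * B₂ with hB
  refine ⟨B, ?_⟩
  intro a b c habc
  -- the least `N` with `rad ≤ S ^ N`
  set r : ℕ := rad a b c
  have hr2 : 2 ≤ r := habc.two_le_rad
  set N : ℕ := Nat.clog S r
  have hN1 : 1 ≤ N := Nat.clog_pos hS2 hr2
  have hrN : r ≤ S ^ N := Nat.le_pow_clog hS2 r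
  have hlt : S ^ (N - 1) < r := by
    have := Nat.pow_pred_clog_lt_self hS2 (x := r) hr2
    simpa [Nat.pred_eq_sub_one] using this
  have hc : (c : ℝ) ≤ Real.exp (N * (q * t + δ * t) + γ * (N : ℝ) ^ φ) :=
    hall N hN1 a b c habc hrN
  -- `N log S < log r + log S`
  have hr0 : 0 < r := by omega
  have hrpos : (0:ℝ) < r := by exact_mod_cast hr0
  set x : ℝ := Real.log r with hx_def
  have hNt : (N : ℝ) * t < x + t := by
    have h1 : ((S : ℝ)) ^ (N - 1) < r := by exact_mod_cast hlt
    have h2 := Real.log_lt_log (pow_pos hSpos _) h1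
    rw [Real.log_pow, Nat.cast_sub hN1] at h2
    push_cast at h2
    rw [← ht_def, ← hx_def] at h2
    linarith
  -- assemble the exponent bound `≤ (q + 2δ) x + B`
  have hN0 : (0:ℝ) ≤ N := Nat.cast_nonneg N
  have hE1 : (N : ℝ) * (q * t + δ * t) ≤ (q + δ) * (x + t) := by
    have h1 := mul_le_mul_of_nonneg_left hNt.le (by positivity : (0:ℝ) ≤ q + δ)
    have e : (N : ℝ) * (q * t + δ * t) = (q + δ) * ((N : ℝ) * t) := by ring
    rw [e]; exact h1
  have hE2 : γ * (N : ℝ) ^ φ ≤ δ * t * N + γ * B₂ := by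
    have := mul_le_mul_of_nonneg_left (hB₂ N hN0) hγpos.le
    have e : γ * (δ * t / γ * N + B₂) = δ * t * N + γ * B₂ := by field_simp
    linarith
  have hE3 : δ * t * N ≤ δ * (x + t) := by
    have := mul_le_mul_of_nonneg_left hNt.le hδ0.le
    linarith
  have hE : (N : ℝ) * (q * t + δ * t) + γ * (N : ℝ) ^ φ ≤ (q + 2 * δ) * x + B := by
    rw [hB]; linarith
  have hexp : Real.exp ((q + 2 * δ) * x + B) = Real.exp B * (r : ℝ) ^ (q + 2 * δ) := by
    rw [Real.rpow_def_of_pos hrpos, ← Real.exp_add, hx_def]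
    congr 1; ring
  calc (c : ℝ) ≤ Real.exp ((q + 2 * δ) * x + B) := hc.trans (Real.exp_le_exp.2 hE)
    _ = Real.exp B * (r : ℝ) ^ (q + 2 * δ) := hexp

/-- **Upper propagation, registered form** (the sub-goal of stmt-ABC-2161 this file serves, stated on
one line with all hypotheses as arrows: it is the signature registered on the item): under the
normalised sub-multiplicativity, goodness with ANY exponent `q` at ONE large scale propagates to
`c ≤ e^B · rad^{q+2δ}` for every abc triple.  This is `upper_propagation`. [folklore] -/
theorem sparseGoodScales_upperPropagation : ∀ (θ L : ℝ) (R₀ : ℕ), 0 ≤ θ → θ < 1 → 0 ≤ L → (∀ R₁ R₂ : ℕ, R₀ ≤ R₁ → R₀ ≤ R₂ → ∀ a b c : ℕ, IsABCTriple a b c → rad a b c ≤ R₁ * R₂ → ∃ a₁ b₁ c₁ a₂ b₂ c₂ : ℕ, IsABCTriple a₁ b₁ c₁ ∧ rad a₁ b₁ c₁ ≤ R₁ ∧ IsABCTriple a₂ b₂ c₂ ∧ rad a₂ b₂ c₂ ≤ R₂ ∧ (c : ℝ) ≤ Real.exp L * Real.exp (Real.log ((R₁ : ℝ) * R₂) ^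 θ) * c₁ * c₂) → ∀ δ : ℝ, 0 < δ → ∃ T : ℝ, ∀ (S : ℕ) (q : ℝ), R₀ ≤ S → 2 ≤ S → T ≤ Real.log S → 0 ≤ q → (∀ a b c : ℕ, IsABCTriple a b c → rad a b c ≤ S → (c : ℝ) ≤ (S : ℝ) ^ q) → ∃ B : ℝ, ∀ a b c : ℕ, IsABCTriple a b c → (c : ℝ) ≤ Real.exp B * ((rad a b c : ℕ) : ℝ) ^ (q + 2 * δ) :=
  fun _θ _L _R₀ hθ0 hθ1 hL hsub _δ hδ => upper_propagation hθ0 hθ1 hL hsub hδ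

end Summit.ABC.ABC.Theorems.SparseGoodScales
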